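import Literature.Algebra.EuclideanLattices.SuccessiveMinimaHermiteConstant
import HarnessLib

/-!
# Discharge of `bddAbove_hermiteSet` (Cassels III §2)

Trunk: Lattice (`Algebra/EuclideanLattices`). Theorems-only companion of
`Literature/Algebra/EuclideanLattices/SuccessiveMinima.lean`, discharging its named fact
`Literature.Algebra.EuclideanLattices.bddAbove_hermiteSet` (for every `n`, the Hermite
invariants `λ₁(L)² / covol(L)^{2/n}` of the full-rank lattices `L ⊆ ℝⁿ` are bounded above)
under the canonical D-0014 name `bddAbove_hermiteSet_holds`, directly from Minkowski's bound
`natCast_mem_upperBounds_hermiteSet : (n : ℝ) ∈ upperBounds (hermiteSet n)` of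
`SuccessiveMinimaHermiteConstant.lean` (Minkowski's convex body theorem with the cube, Cassels
Ch. III §2.2 Theorem II / §2.3 Theorem III). This is the ONLY theorem of the tree whose statement
is the fact `bddAbove_hermiteSet`: the earlier twin `bddAbove_hermiteSet_dim` of
`SuccessiveMinimaHermiteConstant.lean` (same statement, non-canonical name) is retired in favour
of this canonical discharge (dedup-00516), and users of `(h : bddAbove_hermiteSet)` are fed
`bddAbove_hermiteSet_holds`. Kept in its own file so that `SuccessiveMinimaProofs.lean` (the
discharges of the other facts of the statement file) does not acquire the geometry-of-numbers
imports of `SuccessiveMinimaHermiteConstant.lean`.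

## References

* J. W. S. Cassels, *An Introduction to the Geometry of Numbers*, Springer Classics in
  Mathematics (1997 reprint), Ch. II §3 (Hermite's constant), Ch. III §2.2 Theorem II and §2.3
  Theorem III (Minkowski's convex body theorem and the bound it gives) [Cassels1997].
-/

noncomputable section

namespace Literature.Algebra.EuclideanLattices

/-- **Discharge of `bddAbove_hermiteSet`**: for every `n` the set of Hermite invariants
`λ₁(L)² / covol(L)^{2/n}` of the `n`-dimensional full-rank lattices is bounded above — by `n`,
Minkowski's bound with the cube (`natCast_mem_upperBounds_hermiteSet`).
[cite: Cassels1997, Ch. III §2.3 Thm III] -/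
theorem bddAbove_hermiteSet_holds : bddAbove_hermiteSet := fun n =>
  ⟨n, natCast_mem_upperBounds_hermiteSet n⟩

end Literature.Algebra.EuclideanLattices

end
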